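import Mathlib.Analysis.SpecificLimits.Basic
import Literature.Probability.Percolation.PercolationProofs
import Literature.Probability.Percolation.QSMPolynomials

/-!
# Disproof attempts — crux `CriticalCurveRegular` (stmt-CriticalPhenomena-16065,
# route `PercExchangeRateTransport`, sub-problem `PercolationContinuityZ3`)

Crux (by name): `Theses.PercExchangeRateTransport.CriticalCurveRegular` — for the label-coupled
anisotropic bond family on `ℤ²×ℤ` (`x`/`y`-bond open iff `U_e ≤ p`, `z`-bond iff `U_e ≤ t`,
`U` i.i.d. uniform under `labelMeasure (Site 3)`), `θ(p,t) = μ{0 percolates}`,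
`p_c(t) = sInf ({p ∈ [0,1] | θ(p,t) > 0} ∪ {1})`:
`ContinuousOn p_c (0,1) ∧ ∀ t ∈ (0,1), 0 < p_c(t) < 1`.

## Findings (cycle 1, refuter-cdisprove-stmt-CriticalPhenomena-16065-0, 2026-08-17)

* VERDICT: no kill. The crux is a closed concrete statement (no hypotheses, no interface); it
  elaborates (rc 0), `simp`/`norm_num`/`aesop`/`exact?` (for `S` and for `¬S`) all fail; the model
  is genuine (the factor `volume.restrict (Icc 0 1)` IS a probability measure as a `Prop`, so
  `Measure.infinitePi` takes its non-junk branch; `sInf (S ∪ {1})` with `S ⊆ [0,1]` is never junk).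
  Mathematically it is the ONE-SIDED Aizenman–Grimmett shear (`∂_tΘ_n ≤ C(K) ∂_pΘ_n` on compact
  `K ⊂ (0,1)²`, uniform in `n`) + `p_c` nonincreasing + `(1-t)/8 ≤ p_c(t) ≤ p_c(ℤ²) < 1`; every
  step was re-derived on paper here (see § Line `locmod`).
* LOAD-BEARING SIDE CONDITION (proved below, § A): the bound clause cannot be extended to the right
  endpoint — at `t = 1` (indeed for every `t ≥ 1`) the column through `0` is a.s. open, so
  `θ(p,t) = 1` for EVERY real `p` and `p_c(t) = 0`: `criticalCurveRegular_false_without_openRight`,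
  `criticalCurveRegular_false_on_Icc`. So any proof must use `t < 1` in `0 < p_c(t)`. Mechanism:
  `t ↦ θ(0,t)` jumps from `0` to `1` at `t = 1` (`θa_zero_not_continuousAt_one_of`, modulo the
  landed `stub_runBound` at `p = 0`): `θ` is only usc at the top edge.
* NOT load-bearing (information for provers; not refutable): the LEFT endpoint. For `t ≤ 0` no
  vertical bond is open (a.s. for `t = 0`), the model is a stack of independent planes and
  `p_c(t) = p_c(ℤ²) = 1/2 ∈ (0,1)`; `p_c` is nonincreasing on `ℝ`, `= 1/2` on `(-∞,0]`, `= 0` on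
  `[1,∞)`, and (DCT finite-size criterion at `(p,0)`, `p < 1/2`, is open in `t`; block comparison
  near `t = 1`) continuous at both endpoints — so the natural strengthenings
  `ContinuousOn p_c (Icc 0 1)` / `Continuous p_c` are very plausibly TRUE and were not attacked
  further. A UNIFORM Lipschitz bound on `(0,1)` is plausibly FALSE (crossover exponent at the
  planar end: `1/2 - p_c(t) ≍ t^{18/43}` conjecturally, arXiv:1706.07495 Conj. 1) but no cheap
  certificate exists; the crux only needs local Lipschitz, which the line proves.
* STRENGTHENING `StrictAntiOn p_c (Ioo 0 1)` (two-sided AG) — true folklore, not needed, not attacked.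
* LINE `locmod` (picked; stubs 1–5 + core + clusters ALREADY LANDED as Theorems files by
  2026-08-17T14:38Z; only `stub_locModScheme` open): every stub re-derived TRUE as typed (§ C
  docstrings: the constants `8` and `μ₀^{-N} 2^N N`, the `n = 0` / `n ≤ 4` corners, the frozen
  diagonal pairs `s(x,x) ∈ (box 3 n).sym2`, pivotality convention `Xor (insert) (diff)`); joint
  sufficiency is kernel-checked (`CriticalCurveRegular_of` in `Lines/locmod.lean`, rc 0, sorries =
  stubs). The three-case window surgery of `stub_locModScheme` (generic / origin / face, `n ≥ 5`;
  full-box window for `n ≤ 4`) was checked case by case on paper here; no gap found (details § C).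
* Stub-level tightness (§ D, proved): the abstract AG engine (`stub_twoClassShear`, landed) is FALSE
  without its window-size bound — the shear constant must grow with the window
  (`twoClassShear_false_without_windowBound`, explicit 4-coordinate model, `norm_num`).
* Barriers: `SlabLimitUniformControl`, `SprinklingRenormalisation` not engaged (finite-volume
  derivative comparison on compact rectangles of the open square); `LongRangeDiscontinuity` /
  `TreesPercolatingAtCriticality` consistent delimiters (there the window cost is unbounded).
  Negatives index for the sub (TiltGluing, CoverIsCovering, QuarantineInequality): no overlap.
-/

noncomputable section

open MeasureTheory Set
open Literature.Probability.Percolation Literature.Probability.LatticeModels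

namespace Summit.CriticalPhenomena.PercolationContinuityZ3.Cruxes.CriticalCurveRegular.Disproof

/-! ## Vocabulary: the crux's `let`s, so that the crux unfolds to them by `Iff.rfl` -/

/-- A pair is a vertical bond: `e = {x, x + e₃}`. -/
def vert (e : Sym2 (Site 3)) : Prop := ∃ x : Site 3, e = s(x, x + Pi.single (2 : Fin 3) 1)

/-- The label-coupled anisotropic configuration at densities `(p, t)`. -/
def cfg (p t : ℝ) (U : Sym2 (Site 3) → ℝ) : Set (Sym2 (Site 3)) :=
  {e | e ∈ (zdGraph 3).edgeSet ∧ ((vert e ∧ U e ≤ t) ∨ (¬ vert e ∧ U e ≤ p))}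

/-- `θ(p,t) = μ{0 percolates in cfg p t}`. -/
def θa (p t : ℝ) : ℝ := (labelMeasure (Site 3)).real {U | cfg p t U ∈ percolatesAt (0 : Site 3)}

/-- The anisotropic critical curve `p_c(t)`. -/
def pc (t : ℝ) : ℝ := sInf ({p : ℝ | 0 ≤ p ∧ p ≤ 1 ∧ 0 < θa p t} ∪ {1})

/-! ANCHOR (checked rc 0 at 2026-08-17T14:44Z and 15:06Z with `import
Summits.CriticalPhenomena.PercolationContinuityZ3.Theses.PercExchangeRateTransport`, see the folder copy
`run/sessions/refuter-cdisprove-stmt-CriticalPhenomena-16065-0/folder/Disproof.lean`):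

    theorem criticalCurveRegular_iff :
        Theses.PercExchangeRateTransport.CriticalCurveRegular ↔
          ContinuousOn pc (Set.Ioo 0 1) ∧ ∀ t ∈ Set.Ioo (0 : ℝ) 1, 0 < pc t ∧ pc t < 1 :=
      Iff.rfl

This PUBLISHED copy drops the route import (and hence the anchor) only because the farm could not
serve the route module coherently during this cycle (`remote:incoherent … mismatch`, 14:42–15:15Z);
the vocabulary below is character-for-character the crux's `let`-prefix. The two landed Negative files
(`Theorems/CriticalCurveRegular/Negative/RightEndpoint.lean`, p168147;
`Theorems/CriticalCurveRegular/Negative/ShearWindowBound.lean`, p168120) state their theorems over the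
crux's own `let`-prefix / the stub's verbatim text. -/

/-! ## A. The right endpoint `t = 1` is load-bearing: `θ(p,t) = 1` and `p_c(t) = 0` for `t ≥ 1` -/

/-- The column sites `k e₃`, `k : ℕ`. -/
def col (k : ℕ) : Site 3 := Pi.single (2 : Fin 3) (k : ℤ)

/-- The column bonds `{k e₃, (k+1) e₃}`. -/
def colEdge (k : ℕ) : Sym2 (Site 3) := s(col k, col k + Pi.single (2 : Fin 3) 1)

theorem col_zero : col 0 = 0 := by
  simp [col]

theorem col_succ (k : ℕ) : col (k + 1) = col k + Pi.single (2 : Fin 3) 1 := by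
  simp only [col, ← Pi.single_add, Nat.cast_add, Nat.cast_one]

theorem col_injective : Function.Injective col := by
  intro a b h
  have h2 := congrFun h 2
  simp only [col, Pi.single_eq_same, Nat.cast_inj] at h2
  exact h2

/-- A column bond with label `≤ t` is open in `cfg p t U` (it is a vertical lattice bond). -/
theorem colEdge_mem_cfg {p t : ℝ} {U : Sym2 (Site 3) → ℝ} {k : ℕ} (h : U (colEdge k) ≤ t) :
    colEdge k ∈ cfg p t U :=
  ⟨(SimpleGraph.mem_edgeSet _).2 ((zdGraph_adj_iff _ _).2 ⟨2, Or.inl rfl⟩),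
    Or.inl ⟨⟨col k, rfl⟩, h⟩⟩

/-- If every column bond has label `≤ t`, the whole column `{k e₃ : k ∈ ℕ}` lies in `C(0)`. -/
theorem reachable_col {p t : ℝ} {U : Sym2 (Site 3) → ℝ} (hU : ∀ k : ℕ, U (colEdge k) ≤ t)
    (k : ℕ) : (openGraph (cfg p t U)).Reachable 0 (col k) := by
  induction k with
  | zero => rw [col_zero]
  | succ k ih =>
    refine ih.trans (SimpleGraph.Adj.reachable ?_)
    rw [openGraph_adj, col_succ]
    refine ⟨colEdge_mem_cfg (hU k), fun h => ?_⟩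
    have h' : col k = col (k + 1) := by rw [col_succ]; exact h
    exact absurd (col_injective h') (Nat.succ_ne_self k).symm

/-- The good label set: every column bond has label `≤ 1`. -/
def good : Set (Sym2 (Site 3) → ℝ) := {U | ∀ k : ℕ, U (colEdge k) ≤ 1}

/-- On `good`, the origin percolates in `cfg p t` as soon as `t ≥ 1`, for EVERY real `p`. -/
theorem good_subset (p : ℝ) {t : ℝ} (ht : 1 ≤ t) :
    good ⊆ {U | cfg p t U ∈ percolatesAt (0 : Site 3)} := by
  intro U hU
  show (openCluster (cfg p t U) 0).Infinite
  have hsub : Set.range col ⊆ openCluster (cfg p t U) 0 := by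
    rintro _ ⟨k, rfl⟩
    exact reachable_col (fun k => (hU k).trans ht) k
  exact (Set.infinite_range_of_injective col_injective).mono hsub

/-- One label exceeds `1` with probability `0` (the factor law is `Leb|[0,1]`). -/
theorem measure_label_gt_one (e : Sym2 (Site 3)) :
    labelMeasure (Site 3) {U | 1 < U e} = 0 := by
  have : IsProbabilityMeasure ((volume : Measure ℝ).restrict (Set.Icc (0 : ℝ) 1)) :=
    isProbabilityMeasure_volume_restrict_unitInterval
  have hmap := Measure.infinitePi_map_eval (fun _ : Sym2 (Site 3) =>
    (volume : Measure ℝ).restrict (Set.Icc (0 : ℝ) 1)) e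
  have h1 : labelMeasure (Site 3) {U | 1 < U e} =
      ((labelMeasure (Site 3)).map fun U : Sym2 (Site 3) → ℝ => U e) (Set.Ioi 1) := by
    rw [Measure.map_apply (measurable_pi_apply e) measurableSet_Ioi]; rfl
  have h2 : Set.Ioi (1 : ℝ) ∩ Set.Icc 0 1 = ∅ := by
    ext u
    simp only [Set.mem_inter_iff, Set.mem_Ioi, Set.mem_Icc, Set.mem_empty_iff_false, iff_false,
      not_and, not_le]
    intro hu _
    exact hu
  rw [h1, show labelMeasure (Site 3) = Measure.infinitePi (fun _ : Sym2 (Site 3) =>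
    (volume : Measure ℝ).restrict (Set.Icc (0 : ℝ) 1)) from rfl, hmap,
    Measure.restrict_apply measurableSet_Ioi, h2, measure_empty]

theorem measurableSet_good : MeasurableSet good := by
  have : good = ⋂ k : ℕ, {U : Sym2 (Site 3) → ℝ | U (colEdge k) ≤ 1} := by
    ext U; simp [good]
  rw [this]
  exact MeasurableSet.iInter fun k => measurableSet_le (measurable_pi_apply _) measurable_const

/-- The good set has full measure. -/
theorem measure_good : labelMeasure (Site 3) good = 1 := by
  have hP := isProbabilityMeasure_labelMeasure (Site 3)
  have hcompl : labelMeasure (Site 3) goodᶜ = 0 := by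
    have hsub : goodᶜ ⊆ ⋃ k : ℕ, {U : Sym2 (Site 3) → ℝ | 1 < U (colEdge k)} := by
      intro U hU
      simp only [good, Set.mem_compl_iff, Set.mem_setOf_eq, not_forall, not_le] at hU
      obtain ⟨k, hk⟩ := hU
      exact Set.mem_iUnion.2 ⟨k, hk⟩
    exact measure_mono_null hsub ((measure_iUnion_null_iff).2 fun k => measure_label_gt_one _)
  exact (prob_compl_eq_zero_iff measurableSet_good).1 hcompl

/-- **For `t ≥ 1` the origin percolates almost surely, whatever `p` (even `p < 0`).** -/
theorem θa_eq_one_of_one_le (p : ℝ) {t : ℝ} (ht : 1 ≤ t) : θa p t = 1 := by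
  have hP := isProbabilityMeasure_labelMeasure (Site 3)
  apply le_antisymm measureReal_le_one
  calc (1 : ℝ) = (labelMeasure (Site 3)).real good := by
        rw [measureReal_def, measure_good, ENNReal.toReal_one]
    _ ≤ (labelMeasure (Site 3)).real {U | cfg p t U ∈ percolatesAt (0 : Site 3)} :=
        measureReal_mono (good_subset p ht) (measure_ne_top _ _)

/-- The set whose infimum is `p_c(t)` is bounded below by `0`. -/
theorem pcSet_bddBelow (t : ℝ) : BddBelow ({p : ℝ | 0 ≤ p ∧ p ≤ 1 ∧ 0 < θa p t} ∪ {1}) :=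
  ⟨0, by
    rintro p (⟨hp, -⟩ | hp)
    · exact hp
    · rw [Set.mem_singleton_iff] at hp; rw [hp]; exact zero_le_one⟩

theorem pc_nonneg (t : ℝ) : 0 ≤ pc t :=
  le_csInf ⟨1, Or.inr rfl⟩ fun p hp => by
    rcases hp with ⟨hp, -⟩ | hp
    · exact hp
    · rw [Set.mem_singleton_iff] at hp; rw [hp]; exact zero_le_one

/-- **`p_c(t) = 0` for every `t ≥ 1`** (in particular `p_c(1) = 0`). -/
theorem pc_eq_zero_of_one_le {t : ℝ} (ht : 1 ≤ t) : pc t = 0 := by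
  have h0 : (0 : ℝ) ∈ {p : ℝ | 0 ≤ p ∧ p ≤ 1 ∧ 0 < θa p t} ∪ {1} :=
    Or.inl ⟨le_rfl, zero_le_one, by rw [θa_eq_one_of_one_le 0 ht]; exact one_pos⟩
  exact le_antisymm (csInf_le (pcSet_bddBelow t) h0) (pc_nonneg t)

/-- **The mechanism behind the load-bearing `t < 1`: `t ↦ θ(0,t)` JUMPS from `0` to `1` at `t = 1`.**
Stated modulo the hypothesis `hRB : θ(0,t) = 0 for 0 ≤ t < 1`, which is the `p = 0` instance of the
LANDED stub `Locmod.stub_runBound` (Theorems/PercExchangeRateTransportCriticalCurveRegularRunBound.lean,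
p166642; not imported here only to keep this workfile independent of freshly landed modules):
`θ(0,·)` is not continuous at `1` — so `θ = inf_n Θ_n` is only upper semicontinuous at the top edge
although every finite-volume `Θ_n` is continuous there. -/
theorem θa_zero_not_continuousAt_one_of (hRB : ∀ t : ℝ, 0 ≤ t → t < 1 → θa 0 t = 0) :
    ¬ ContinuousAt (fun t : ℝ => θa 0 t) 1 := by
  intro hc
  have hu : Filter.Tendsto (fun n : ℕ => 1 - 1 / ((n : ℝ) + 1)) Filter.atTop (nhds 1) := by
    have h := (tendsto_one_div_add_atTop_nhds_zero_nat (𝕜 := ℝ))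
    simpa using (tendsto_const_nhds (x := (1 : ℝ))).sub h
  have hcomp := hc.tendsto.comp hu
  have hzero : (fun t : ℝ => θa 0 t) ∘ (fun n : ℕ => 1 - 1 / ((n : ℝ) + 1)) = fun _ => 0 := by
    funext n
    have hn : (0 : ℝ) < (n : ℝ) + 1 := by positivity
    have h1 : 1 / ((n : ℝ) + 1) ≤ 1 := by
      rw [div_le_one hn]; linarith [(Nat.cast_nonneg n : (0 : ℝ) ≤ n)]
    have h2 : 0 < 1 / ((n : ℝ) + 1) := by positivity
    exact hRB _ (by linarith) (by linarith)
  rw [hzero] at hcomp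
  have h01 := tendsto_nhds_unique (tendsto_const_nhds (x := (0 : ℝ))) hcomp
  simp only [θa_eq_one_of_one_le 0 le_rfl] at h01
  exact zero_ne_one h01

/-- Variant (a): the crux with the side condition `t < 1` DROPPED from the bounds clause. -/
def CriticalCurveRegularWithoutOpenRight : Prop :=
  ContinuousOn pc (Set.Ioo 0 1) ∧ ∀ t : ℝ, 0 < t → 0 < pc t ∧ pc t < 1

/-- **Any proof must use `t < 1`:** without it the bounds clause fails at `t = 1` (`p_c(1) = 0`). -/
theorem criticalCurveRegular_false_without_openRight : ¬ CriticalCurveRegularWithoutOpenRight := by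
  intro h
  have h1 := (h.2 1 one_pos).1
  rw [pc_eq_zero_of_one_le le_rfl] at h1
  exact lt_irrefl _ h1

/-- Variant (c): the natural strengthening to the CLOSED parameter interval in the bounds clause. -/
def CriticalCurveRegularOnIcc : Prop :=
  ContinuousOn pc (Set.Ioo 0 1) ∧ ∀ t ∈ Set.Icc (0 : ℝ) 1, 0 < pc t ∧ pc t < 1

/-- **The closed-interval strengthening is false** (again `p_c(1) = 0`). -/
theorem criticalCurveRegular_false_on_Icc : ¬ CriticalCurveRegularOnIcc := by
  intro h
  have h1 := (h.2 1 ⟨zero_le_one, le_rfl⟩).1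
  rw [pc_eq_zero_of_one_le le_rfl] at h1
  exact lt_irrefl _ h1

/-- Tightness (b): the positivity bound `0 < p_c(t)` degenerates exactly at the excluded endpoint:
`p_c` vanishes identically on `[1, ∞)`, so no positive lower bound for `p_c` can be uniform on
`(0,1)` (consistent with the line's `p_c(t) ≥ (1-t)/8`). -/
theorem pc_eq_zero_on_Ici : ∀ t ∈ Set.Ici (1 : ℝ), pc t = 0 := fun _ ht => pc_eq_zero_of_one_le ht

/-! ## B. Left endpoint and global shape of `p_c` (analysis only — nothing refutable)

* `t ≤ 0`: for `t < 0` no vertical bond is ever open (`U_e ≥ 0` a.s.; for `t = 0` a.s.), the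
  configuration is a stack of independent planar bond percolations and only the plane `z = 0` meets
  `C(0)`, so `θ(p,t) = θ_{ℤ²}(p)` and `p_c(t) = p_c(ℤ²) = 1/2 ∈ (0,1)`. Hence the side condition
  `0 < t` is NOT load-bearing for the bounds clause (information for provers: only `t < 1` is).
* Continuity at `0⁺`: `lim_{t↓0} p_c(t) = 1/2` (for `p < 1/2` the DCT finite-size criterion
  `φ_{(p,0)}(Λ_m) < 1` holds for some `m` by planar exponential decay and is an open condition in
  `t` — finitely many bonds). Continuity at `1⁻`: `p_c(1-ε) ≤ K ε → 0` by a block comparison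
  (columns of height `c/ε` fully open w.p. `≈ e^{-c}`, neighbouring columns linked w.p.
  `1 - e^{-pc/ε}`). So `Continuous p_c` on `ℝ` (`≡ 1/2` on `(-∞,0]`, `≡ 0` on `[1,∞)`) is very
  plausibly TRUE: the strengthening `ContinuousOn p_c (Icc 0 1)` was not attacked further.
* A UNIFORM Lipschitz constant on `(0,1)` is plausibly false (planar crossover:
  `1/2 - p_c(t) ≍ t^{18/43}` conjecturally, Sanchis–Silva arXiv:1706.07495), but there is no cheap
  certificate; the crux needs only LOCAL Lipschitz on compacts of `(0,1)`, which is what the line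
  proves (shear constant `μ₀^{-N} 2^N N` with `μ₀ = min(lo, 1-hi, plo, 1-phi, 1/2)`).

## C. Line `locmod` — stub-by-stub falsification attempts (all six stubs survive; 1–5 landed)

Typing points checked (each could have hidden a junk value; none does):
* `stub_runBound` (`θ = 0` for `0 ≤ t < 1`, `0 ≤ p`, `8p < 1-t`): the counting constant is right —
  an open self-avoiding path with `N` horizontal steps, truncated after the `N`-th, has total weight
  `≤ (4p · Σ_{r∈ℤ} t^{|r|})^N = (4p(1+t)/(1-t))^N`, and `(1-t)/8 ≤ (1-t)/(4(1+t))` iff `t ≤ 1`;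
  `|C(0)| = ∞` forces open SAWs with arbitrarily many horizontal steps because for fixed `N` the
  expected number of open SAWs from `0` with `< N` horizontal steps is finite (`t < 1`). At `t = 1`
  the statement is correctly NOT claimed (§A: `θ(p,1) = 1`).
* `stub_planeMinorant` (all real `t`, `p ∈ [0,1]`): true even for `t < 0` (the plane `z = 0` uses
  horizontal bonds only).
* `stub_thetaInf` (all real `p,t`): `percolatesAt 0 = ⋂ₙ siteToBoundary 3 n` on configurations
  `⊆ E(ℤ³)` (a lattice path changes `‖·‖∞` by `≤ 1` per step, so a path leaving `Λ_n` first meets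
  `∂Λ_n` inside `Λ_n`); `n = 0` contributes `Θ_0 = 1` (harmless in `⨅`); continuity from above needs
  only measurability of the finite-box events.
* `stub_boxLaw` (`p,t ∈ [0,1]`): `K = (box 3 n).sym2` contains the diagonal pairs `s(x,x)` and all
  non-adjacent pairs — they get parameter `0`, so configurations containing them have weight `0` and
  `gTheta` is the law of `cfg ∩ E(Λ_n)`; the event is determined by the pairs of the box
  (`openConnIn ↑(box 3 n)`); one-label marginals `P(U_e ≤ q) = q` need exactly `q ∈ [0,1]`.
* `stub_twoClassShear` (abstract): weight ratio `gW(S)/gW(S') ≤ μ₀^{-N}` because `S, S'` differ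
  only on `Cw e ∩ K` (`≤ N` coordinates), where `S' ⊆ KV ∪ KH` has factors `≥ μ₀` and `S` has
  factors `≤ 1`; fibres of `(e,S) ↦ (f,S')`: `≤ N` choices of `e` (overlap hypothesis) times `≤ 2^N`
  choices of `S ∩ Cw e`; Russo `∂gTheta/∂q_i = gPiv_i` (pairing `S ↔ S ∪ {i}`); along
  `u ↦ (p + Cu, t - u)`, `u ∈ [0,h]`, all parameters stay in `[μ₀, 1-μ₀]` by the four hypotheses.
  Both the window-size and the overlap hypotheses are load-bearing for the constant: § D proves
  `¬ TwoClassShearWithoutWindowBound` on a four-coordinate model (one window of size 4, `N = 1`);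
  the overlap twin (one `f` shared by `M` windows, `A = {some coordinate open}`, `M(1-p) > C(1-t)`)
  is analogous and not formalised (the stub itself is landed, p166667).
* `stub_locModScheme` (deterministic, the open stub): the three-case window surgery of the line card
  was re-verified here edge by edge. Points a formaliser must not skip:
  (i) generic case (`3 ≤ ‖x‖∞ ≤ n-3`, `Q = x + {-2..2}³`, so `0 ∉ Q`, `Q ∩ ∂Λ_n = ∅`): with `π₀`
  an open path of `S ∪ {e}` in `Λ_n` from `0` cut at its FIRST vertex of `∂Λ_n` (it traverses `e`,
  else `S ∖ {e} ∈ A`), `u`/`v` = first/last vertex of `π₀` in `Q` are DISTINCT (π₀ visits both ends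
  of `e`), `g_u ≠ e ≠ g_v` (one endpoint outside `Q`), so `g_u, g_v ∈ S`; `S' = (S ∖ T(Q)) ∪
  {g_u, g_v} ∪ P` with `P` ANY simple `u → v` path inside `Q` containing a horizontal bond `f`
  (no need to avoid `∂Q`); a simple `f`-less witness either avoids `T(Q)` (then it is open in
  `S ∖ {e}`: contradiction) or enters `Q` — only through `g_u`/`g_v`, hence exactly once, and must
  join `u` to `v` inside `P ∖ {f}`: impossible. `S, S'` agree off `T(Q) = edgesTouching Q ∋ e`.
  (ii) origin case (`‖x‖∞ ≤ 2`, `n ≥ 5`, `Q = {-3..3}³`, `Q ∩ ∂Λ_n = ∅`): `v ≠ 0` (π₀ is simple and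
  traverses `e ⊆ Q` before leaving `Q`); `S' = (S ∖ T(Q)) ∪ {g_v} ∪ P`, `P : 0 → v`; without `f`
  the origin's piece of `P ∖ {f}` never leaves `Q`.
  (iii) face case (`‖x‖∞ ≥ n-2`, `n ≥ 5`, `Q = (x+{-2..2}³) ∩ Λ_n ∌ 0`): `u ∉ ∂Λ_n` BECAUSE `π₀`
  was cut at its first boundary vertex and `u` precedes the traversal of `e`; `f` = the FIRST bond of
  `P` at `u` must be horizontal and inside `Q ∩ Λ_n` — it exists since every side of `Q ∩ Λ_n` has
  `≥ 3` sites (`x, x+e₃ ∈ Λ_n`); `P ∖ {f}` continues `u' → z ∈ Q ∩ ∂Λ_n` avoiding `u` (a box with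
  sides `≥ 2` minus a point is connected; `z ≠ u` as `u ∉ ∂Λ_n`); without `f` a witness entering at
  `u` (only entrance `g_u`) is stuck at `u ∉ ∂Λ_n`.
  (iv) `n ≤ 4`: full-box window, `S'` = the straight `x`-path from `0`, its first bond is pivotal
  (`0 ∉ ∂Λ_n` for `n ≥ 1`); `n = 0`: `KV 0 = ∅`, vacuous. `N` is existential, so the full-box
  windows (`|E(Λ_4)| = 1944`) are admissible.
  (v) the lead's variant (idea `isolation-descent`, PICKED.md): `ω = S ∖ {e}`, `C` = cluster of `0`
  in `ω` inside `Λ_n`, `D` = sites joined to `∂Λ_n` in `ω` inside `Λ_n` (`C ∩ D = ∅` as `ω ∉ A`; `e`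
  joins `C` to `D`); `a` = first `Q`-vertex of an `ω`-path `0 → (end of e in C)`, `b` = last
  `Q`-vertex of an `ω`-path `(end of e in D) → ∂Λ_n`; `S' = (ω ∖ win) ∪ {g_a, g_b} ∪ Col`, target
  `T = KH n ∩ win`. Re-verified here: `a ≠ b` and `a ∉ ∂Λ_n` from `a ∈ C`, `b ∈ D`; closure for
  `S' ∉ A`: every bond at `a` lies in `win`, so `deg_{S'} a ≤ 1` (`g_a`); `b, b⁺ ∈ D` hence
  `∉ C₀ := cluster of 0 in ω ∖ win ⊆ C`; `Q ∩ C₀ ⊆ {0}` and `0 ∈ Col` would force `0 ∈ Q`, `a = 0`,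
  `c = proj a` — excluded; so the `S'`-cluster of `0` is `C₀ ∪ {a}`, which misses `∂Λ_n`. For
  `S' ∪ T ∈ A` the monotone path `0 → a⁻ → a → (layer of a) → Col → (layer of b) → b → b⁺ → ∂Λ_n`
  needs only that `Q ∩ Λ_n` has `≥ 3 × 3` planar positions (true for every `n ≥ 1` since
  `|x_i| ≤ n`) so that `c ∉ {proj a, proj b}` exists; descent (`S' ∉ A`, `S' ∪ T ∈ A`, `T` finite ⟹
  some `f ∈ T` pivotal in some `S' ⊆ S'' ⊆ S' ∪ T`) is a sound induction on `T`. If walks rather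
  than simple paths are used, `a`/`b` must be taken from the cluster-based recipe above (with a
  non-simple walk "first/last vertex in `Q`" may coincide). NO GAP FOUND in either variant; the
  lead's recipe was also put through an independent randomized checker written here
  (`isolation_cluster_check.py`, item evidence 2026-08-17T14:55Z): 4593 pivotal vertical bonds over
  `n = 1..8` (`a = 0`: 3819, `b ∈ ∂Λ_n`: 1517, `Q ⊄ Λ_n`: 779, generic: 320) — (i)–(iv), `a ≠ b`,
  `a ∉ ∂Λ_n`, `S' ⊆ E(Λ_n)`, `f ∈ KH n ∩ win` all pass.
  No counterexample mechanism survives: the only conceivable one (unbounded window cost) is exactly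
  what fails on long-range / tree families (barriers `LongRangeDiscontinuity`,
  `TreesPercolatingAtCriticality`), not on nearest-neighbour `ℤ²×ℤ`.
-/

/-! ## D. Line `locmod`, stub 5: the window-size bound is load-bearing (finite model) -/

/-- The model event on `Fin 4`: coordinate `0` open, or all of `1,2,3` open. -/
def modelA : Set (Set (Fin 4)) := {S | (0 : Fin 4) ∈ S ∨ ((1 : Fin 4) ∈ S ∧ (2 : Fin 4) ∈ S ∧ (3 : Fin 4) ∈ S)}

theorem isUpperSet_modelA : IsUpperSet modelA := by
  intro S T hST hS
  rcases hS with h | ⟨h1, h2, h3⟩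
  · exact Or.inl (hST h)
  · exact Or.inr ⟨hST h1, hST h2, hST h3⟩

/-- The two-class parameter of the model: `t` on `KV = {0}`, `p` on `KH = {1,2,3}`. -/
def modelq (p t : ℝ) : Fin 4 → ℝ :=
  fun i => if i ∈ ({0} : Finset (Fin 4)) then t else if i ∈ ({1, 2, 3} : Finset (Fin 4)) then p else 0

theorem univ_fin4 : (Finset.univ : Finset (Fin 4)) = {0, 1, 2, 3} := by decide

/-- Closed form of the model polynomial: `P(0 open ∨ 1,2,3 open) = t + (1 - t) p³`. -/
theorem gTheta_model (p t : ℝ) :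
    ProdWeight.gTheta (Finset.univ : Finset (Fin 4)) modelA (modelq p t) = t + (1 - t) * p ^ 3 := by
  unfold ProdWeight.gTheta ProdWeight.gW
  simp only [Fin.prod_univ_four]
  rw [univ_fin4]
  rw [Finset.sum_powerset_insert (by decide), Finset.sum_powerset_insert (by decide),
    Finset.sum_powerset_insert (by decide), Finset.sum_powerset_insert (by decide),
    Finset.sum_powerset_insert (by decide), Finset.sum_powerset_insert (by decide),
    Finset.sum_powerset_insert (by decide)]
  rw [← Finset.insert_empty]
  iterate 8 rw [Finset.sum_powerset_insert (by decide)]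
  simp only [Finset.powerset_empty, Finset.sum_singleton]
  simp [modelA, modelq, ProdWeight.gwt]
  ring

/-- Stub 5 of line `locmod` (`stub_twoClassShear`) with its window-SIZE hypothesis
`(∀ e ∈ KV, (Cw e).card ≤ N)` DROPPED (the overlap bound, the local modification and the parameter
box are kept verbatim). -/
def TwoClassShearWithoutWindowBound : Prop :=
  ∀ (ι : Type) [DecidableEq ι] (K KV KH : Finset ι) (A : Set (Set ι)) (Cw : ι → Finset ι)
    (N : ℕ) (μ₀ : ℝ),
    IsUpperSet A → KV ⊆ K → KH ⊆ K → Disjoint KV KH →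
    (∀ f ∈ KH, (KV.filter fun e => f ∈ Cw e).card ≤ N) →
    (∀ e ∈ KV, ∀ S : Finset ι, S ⊆ KV ∪ KH → IsPivotal A e (↑S : Set ι) →
      ∃ S' : Finset ι, S' ⊆ KV ∪ KH ∧ (∃ f ∈ KH, f ∈ Cw e ∧ IsPivotal A f (↑S' : Set ι)) ∧
        ∀ i, i ∉ Cw e → (i ∈ S ↔ i ∈ S')) →
    0 < μ₀ → μ₀ ≤ 1 / 2 →
    ∀ p t h : ℝ, 0 ≤ h → μ₀ ≤ p → p + (μ₀ ^ N)⁻¹ * 2 ^ N * (N : ℝ) * h ≤ 1 - μ₀ →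
      μ₀ ≤ t - h → t ≤ 1 - μ₀ →
      ProdWeight.gTheta K A (fun i => if i ∈ KV then t else if i ∈ KH then p else 0) ≤
        ProdWeight.gTheta K A (fun i => if i ∈ KV then t - h
          else if i ∈ KH then p + (μ₀ ^ N)⁻¹ * 2 ^ N * (N : ℝ) * h else 0)

/-- In the model, the horizontal coordinate `1` is pivotal in the configuration `{2,3}`. -/
theorem isPivotal_one_pair : IsPivotal modelA (1 : Fin 4) (↑({2, 3} : Finset (Fin 4)) : Set (Fin 4)) := by
  rw [ProdWeight.isPivotal_iff_of_upper isUpperSet_modelA]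
  constructor
  · right
    simp
  · intro hmem
    rcases hmem with h0 | ⟨h1, -, -⟩
    · simp at h0
    · simp at h1

/-- **The window-size bound of stub 5 is load-bearing:** without it the shear inequality fails in the
four-coordinate model (`KV = {0}`, `KH = {1,2,3}`, `A = modelA`, window = everything, `N = 1`,
`μ₀ = 1/4`, `(p,t,h) = (1/4, 3/4, 1/64)`, so `C = 8`): `3/4 + 1/256 > 47/64 + (17/64)(3/8)^3`.
Hence the AG constant must grow with the window size (as `μ₀^{-N} 2^N N` does). -/
theorem twoClassShear_false_without_windowBound : ¬ TwoClassShearWithoutWindowBound := by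
  intro h
  have hmod : ∀ e ∈ ({0} : Finset (Fin 4)), ∀ S : Finset (Fin 4), S ⊆ {0} ∪ {1, 2, 3} →
      IsPivotal modelA e (↑S : Set (Fin 4)) →
      ∃ S' : Finset (Fin 4), S' ⊆ {0} ∪ {1, 2, 3} ∧
        (∃ f ∈ ({1, 2, 3} : Finset (Fin 4)), f ∈ (fun _ : Fin 4 => (Finset.univ : Finset (Fin 4))) e ∧
          IsPivotal modelA f (↑S' : Set (Fin 4))) ∧
        ∀ i, i ∉ (fun _ : Fin 4 => (Finset.univ : Finset (Fin 4))) e → (i ∈ S ↔ i ∈ S') := by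
    intro e _ S _ _
    exact ⟨{2, 3}, by decide, ⟨1, by decide, Finset.mem_univ _, isPivotal_one_pair⟩,
      fun i hi => absurd (Finset.mem_univ i) hi⟩
  have hover : ∀ f ∈ ({1, 2, 3} : Finset (Fin 4)),
      (({0} : Finset (Fin 4)).filter fun e => f ∈ (fun _ : Fin 4 => (Finset.univ : Finset (Fin 4))) e).card
        ≤ 1 := by
    intro f _
    exact (Finset.card_filter_le _ _).trans (by simp)
  have key := h (Fin 4) Finset.univ {0} {1, 2, 3} modelA (fun _ => Finset.univ) 1 (1 / 4)
    isUpperSet_modelA (Finset.subset_univ _) (Finset.subset_univ _) (by decide) hover hmod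
    (by norm_num) (by norm_num) (1 / 4) (3 / 4) (1 / 64) (by norm_num) (by norm_num) (by norm_num)
    (by norm_num) (by norm_num)
  change ProdWeight.gTheta Finset.univ modelA (modelq (1 / 4) (3 / 4)) ≤
    ProdWeight.gTheta Finset.univ modelA
      (modelq (1 / 4 + ((1 / 4 : ℝ) ^ 1)⁻¹ * 2 ^ 1 * ((1 : ℕ) : ℝ) * (1 / 64)) (3 / 4 - 1 / 64)) at key
  rw [gTheta_model, gTheta_model] at key
  norm_num at key

end Summit.CriticalPhenomena.PercolationContinuityZ3.Cruxes.CriticalCurveRegular.Disproof
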